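import Summits.AtomisticToContinuum.HydrodynamicLimit.Theorems.OneFlightGossipEngineEquilibriumClampedCollisionalWindowLDRadialVirialTemplate
import Summits.AtomisticToContinuum.HydrodynamicLimit.Theorems.OneFlightGossipEngineEquilibriumClampedCollisionalWindowLDRadialVirialEOS
import Summits.AtomisticToContinuum.HydrodynamicLimit.Theorems.OneFlightGossipEngineEquilibriumClampedCollisionalWindowLDStubCollisionDecomposition
import Literature.MathematicalPhysics.KineticTheory.HardSphereTwoTimePressure

/-!
# Composition of the line `radial-virial-polarization`: C′ from the four radial-virial window-LD statements
(crux `EquilibriumClampedCollisionalWindowLD`, stmt-AtomisticToContinuum-13733; TwoClocks r3 / OneFlightGossipEngine r5)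

**Main result `clampedTransferWindowLD_of_radialVirialLD`** (kernel-checked, axioms `propext/Classical.choice/Quot.sound`): the repaired
crux C′ = `ClampedTransferWindowLD` (the filed `EquilibriumClampedCollisionalWindowLD` with the TRANSFER-activity clamp, stated here in
the named objects `Xrow`/`Arow`/`gibbs`/`window` of the shared vocabulary, `Iff.rfl` with the verbatim text) FOLLOWS from the four open
window-LD statements of the line — the isotropic upper / lower tails (LD virial theorem), the traceless statement (collisional shear)
and the thermal-transfer statement (collisional pressure work) — taken as hypotheses written with the LD template of
`…RadialVirialTemplate`. The filed decl itself is refuted (Newton-cradle relay under the momentum-only clamp;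
`Theorems/EquilibriumClampedCollisionalWindowLD/Negative/*`, cdisprove); this file closes nothing and asserts no LD statement — it is the
TRANSFER rung of the line, `--supports stmt-AtomisticToContinuum-13733`.

Ingredients: `stub_collisionDecomposition` (p110978: pathwise polarisation `w⁻¹X_r = virN Γ_r + O(Vσ(N+1)^{2/3})`), the record
algebra `gamM_split`/`gamE_split` + linearity of `Rvir` on good orbits (`…RadialVirialAlgebra`), the EOS identities `Arow_some_eq` /
`Arow_none_eq` / `isoProjection_pp_np` and the measurability of the pieces (`…RadialVirialEOS`, from p107056 / p107227), and the LD
template. Per row: `Y_r = main_r + Rem_r` with `main_k = Y_{ψ_k⁺} − Y_{ψ_k⁻} + T_{S°_k}`, `main_e = Y_{ψ_e⁺} − Y_{ψ_e⁻} + T_{S°_e} + Θ_{∇φ}`,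
`|Rem_r| ≤ C_φ σ V (N+1)^{2/3}` a.e.; both signs of `main_r` are sums of one-sided LD data, the remainder is an `o(N)` shift, and the
rows are joined along the common quantifier prefix.

prover-line-stmt-AtomisticToContinuum-13733-c2-0, 2026-08-16.
-/

noncomputable section

open MeasureTheory Set Filter
open scoped ENNReal BigOperators
open Literature.Analysis.FluidPDE Literature.MathematicalPhysics.KineticTheory
open Literature.Analysis.FunctionSpaces (Torus.partialDeriv Torus.IsSmooth)

namespace Summit.AtomisticToContinuum.HydrodynamicLimit.Theorems.ClampedTransferCoin

namespace RadialVirial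

/-! ### Assembly: the rows of C′ from the four LD data -/

section Assembly

/-- Rewriting an `UpperLD` datum along a pointwise identity of families. -/
theorem UpperLD.of_eq {μ : (N : ℕ) → Measure (Phase N)} {Y Y' : WFun} (h : ∀ τ V N z, Y τ V N z = Y' τ V N z)
    (hY : UpperLD μ Y) : UpperLD μ Y' := by
  obtain rfl : Y = Y' := funext fun τ => funext fun V => funext fun N => funext fun z => h τ V N z
  exact hY

variable {σ a₀ θ₀ : ℝ} {u₀ : V3}

/-- The Gibbs laws along a flow family. -/
def gibbsFam (σ a₀ θ₀ : ℝ) (u₀ : V3) (Φ : Flows σ) : (N : ℕ) → Measure (Phase N) :=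
  fun N => gibbs σ a₀ θ₀ u₀ N (Φ N)

/-- Continuity of the weights attached to a smooth `φ`. -/
theorem continuous_psiM {φ : T3 → ℝ} (hφ : Torus.IsSmooth φ) (k : Fin 3) : Continuous (psiM φ k) :=
  continuous_const.mul (hφ.partialDeriv k).continuous

/-- `ψ_e` is continuous for smooth `φ`. -/
theorem continuous_psiE (u₀ : V3) {φ : T3 → ℝ} (hφ : Torus.IsSmooth φ) : Continuous (psiE u₀ φ) :=
  continuous_const.mul (continuous_finsetSum _ fun l _ => (hφ.partialDeriv l).continuous.mul continuous_const)

/-- The entries of `Sym(∇φ ⊗ e)` are continuous for smooth `φ`. -/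
theorem continuous_symOuter_grad {φ : T3 → ℝ} (hφ : Torus.IsSmooth φ) (e : Fin 3 → ℝ) (a b : Fin 3) :
    Continuous fun x => symOuter (fun l => Torus.partialDeriv l φ x) e a b := by
  unfold symOuter
  exact (((hφ.partialDeriv a).continuous.mul continuous_const).add
    (continuous_const.mul (hφ.partialDeriv b).continuous)).div_const _

/-- The entries of `S°_k` are continuous for smooth `φ`. -/
theorem continuous_devM {φ : T3 → ℝ} (hφ : Torus.IsSmooth φ) (k : Fin 3) (a b : Fin 3) :
    Continuous fun x => devM φ k x a b := by
  unfold devM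
  refine (continuous_symOuter_grad hφ _ a b).sub ?_
  split_ifs
  · exact continuous_psiM hφ k
  · exact continuous_const

/-- The entries of `S°_e` are continuous for smooth `φ`. -/
theorem continuous_devE (u₀ : V3) {φ : T3 → ℝ} (hφ : Torus.IsSmooth φ) (a b : Fin 3) :
    Continuous fun x => devE u₀ φ x a b := by
  unfold devE
  refine (continuous_symOuter_grad hφ _ a b).sub ?_
  split_ifs
  · exact continuous_psiE u₀ hφ
  · exact continuous_const

/-- `S°_k` is traceless. -/
theorem trace_devM (φ : T3 → ℝ) (k : Fin 3) (x : T3) : ∑ a, devM φ k x a a = 0 := by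
  simp only [devM, symOuter, psiM, Fin.sum_univ_three, ↓reduceIte, Fin.isValue, Pi.single_apply]
  fin_cases k <;> simp <;> ring

/-- `S°_e` is traceless. -/
theorem trace_devE (u₀ : V3) (φ : T3 → ℝ) (x : T3) : ∑ a, devE u₀ φ x a a = 0 := by
  simp only [devE, symOuter, psiE, Fin.sum_univ_three, ↓reduceIte, Fin.isValue]
  ring

variable (Φ : Flows σ)

/-- **The four LD data of the line at fixed `(σ, a₀, θ₀, u₀, Φ)`**: what the composition consumes from S1–S4. -/
structure LDData (σ a₀ θ₀ : ℝ) (u₀ : V3) (Φ : Flows σ) : Prop where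
  upper : ∀ ψ : T3 → ℝ, Continuous ψ → (∀ x, 0 ≤ ψ x) →
    UpperLD (gibbsFam σ a₀ θ₀ u₀ Φ) fun τ V N => isoFluct σ θ₀ u₀ τ V (Φ N) ψ
  lower : ∀ ψ : T3 → ℝ, Continuous ψ → (∀ x, 0 ≤ ψ x) →
    UpperLD (gibbsFam σ a₀ θ₀ u₀ Φ) fun τ V N z => -isoFluct σ θ₀ u₀ τ V (Φ N) ψ z
  traceless : ∀ S : T3 → Fin 3 → Fin 3 → ℝ, (∀ a b, Continuous fun x => S x a b) → (∀ x, ∑ a, S x a a = 0) →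
    TwoSidedLD (gibbsFam σ a₀ θ₀ u₀ Φ) fun τ V N => tracelessFluct σ τ V (Φ N) S
  thermal : ∀ b : Fin 3 → T3 → ℝ, (∀ l, Continuous (b l)) →
    TwoSidedLD (gibbsFam σ a₀ θ₀ u₀ Φ) fun τ V N => thermalFluct σ θ₀ u₀ τ V (Φ N) b

variable {Φ}

/-- The window-normalised row functional of C′: `Y_r = w⁻¹ X_r − w⁻¹ A_r`. -/
def rowY (σ θ₀ : ℝ) (u₀ : V3) (φ : T3 → ℝ) (Φ : Flows σ) (r : Option (Fin 3)) : WFun :=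
  fun τ V N z => (window τ N)⁻¹ * Xrow σ τ V φ (Φ N) r z - (window τ N)⁻¹ * Arow σ θ₀ u₀ τ φ (Φ N) r z

/-- **Momentum row `k` of C′ at fixed data**, two-sided. -/
theorem twoSided_rowY_some (hσ : 0 < σ) (hσ2 : σ < 1 / 2) (hD : LDData σ a₀ θ₀ u₀ Φ) {φ : T3 → ℝ}
    (hφ : Torus.IsSmooth φ) (k : Fin 3) :
    TwoSidedLD (gibbsFam σ a₀ θ₀ u₀ Φ) (rowY σ θ₀ u₀ φ Φ (some k)) := by
  obtain ⟨C, hC0, hC⟩ := stub_collisionDecomposition φ hφ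
  set ψ := psiM φ k with hψ
  have hψc : Continuous ψ := continuous_psiM hφ k
  set μ := gibbsFam σ a₀ θ₀ u₀ Φ with hμ
  -- the main part and the remainder
  set main : WFun := fun τ V N z =>
    isoFluct σ θ₀ u₀ τ V (Φ N) (pp ψ) z + -isoFluct σ θ₀ u₀ τ V (Φ N) (np ψ) z +
      tracelessFluct σ τ V (Φ N) (devM φ k) z with hmain
  set rem : WFun := fun τ V N z => rowY σ θ₀ u₀ φ Φ (some k) τ V N z - main τ V N z with hrem
  -- the remainder is small on the good set
  have hrem_bd : ∀ τ V N, 0 < τ → 0 ≤ V → ∀ᵐ z ∂(μ N), |rem τ V N z| ≤ C * σ * V * ((N : ℝ) + 1) ^ (2 / 3 : ℝ) := by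
    intro τ V N hτ hV
    filter_upwards [ae_mem_good_localGibbsLaw σ (fun _ => a₀) (fun _ => u₀) (fun _ => θ₀) N (Φ N)] with z hz
    have h5 := ((hC σ τ V hσ hσ2 hτ hV N (Φ N) z hz).1 k)
    have h5' : |rowY σ θ₀ u₀ φ Φ (some k) τ V N z + (window τ N)⁻¹ * Arow σ θ₀ u₀ τ φ (Φ N) (some k) z -
        virN σ τ V (Φ N) (gamM φ k) z| ≤ C * V * σ * ((N : ℝ) + 1) ^ (2 / 3 : ℝ) := by
      simp only [rowY, sub_add_cancel]
      exact h5
    -- the collision side splits exactly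
    have hcoll : virN σ τ V (Φ N) (gamM φ k) z =
        virN σ τ V (Φ N) (fun c => pp ψ c.fstPos) z - virN σ τ V (Φ N) (fun c => np ψ c.fstPos) z +
          virN σ τ V (Φ N) (quadWeight (devM φ k)) z := by
      have e1 : virN σ τ V (Φ N) (gamM φ k) z =
          virN σ τ V (Φ N) (fun c => psiM φ k c.fstPos + quadWeight (devM φ k) c) z := by
        simp only [virN, Rvir_gamM hσ]
      rw [e1, virN_add (Φ N) hz, ← virN_sub (Φ N) hz]
      congr 2
      funext c
      exact (pp_sub_np ψ c.fstPos).symm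
    -- the EOS side splits exactly
    have heos : Arow σ θ₀ u₀ τ φ (Φ N) (some k) z =
        isoProjection σ θ₀ u₀ τ (Φ N) (pp ψ) z - isoProjection σ θ₀ u₀ τ (Φ N) (np ψ) z := by
      rw [Arow_some_eq (Φ N) hφ k z]
      exact isoProjection_pp_np hσ hσ2 hτ (Φ N) hψc hz
    have hid : rem τ V N z = rowY σ θ₀ u₀ φ Φ (some k) τ V N z +
        (window τ N)⁻¹ * Arow σ θ₀ u₀ τ φ (Φ N) (some k) z - virN σ τ V (Φ N) (gamM φ k) z := by
      simp only [hrem, hmain, isoFluct, tracelessFluct, hcoll, heos]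
      ring
    rw [hid]
    calc _ ≤ C * V * σ * ((N : ℝ) + 1) ^ (2 / 3 : ℝ) := h5'
      _ = C * σ * V * ((N : ℝ) + 1) ^ (2 / 3 : ℝ) := by ring
  -- measurability of the partial sums of the main part
  have hm1 : AEMeasFam μ fun τ V N => isoFluct σ θ₀ u₀ τ V (Φ N) (pp ψ) := ⟨fun τ V N hτ _ =>
    aemeasurable_isoFluct hσ hσ2 hτ (Φ N) (continuous_pp hψc)⟩
  have hm1n : AEMeasFam μ fun τ V N z => -isoFluct σ θ₀ u₀ τ V (Φ N) (pp ψ) z := ⟨fun τ V N hτ hV =>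
    (hm1.out τ V N hτ hV).neg⟩
  have hm2 : AEMeasFam μ fun τ V N => isoFluct σ θ₀ u₀ τ V (Φ N) (np ψ) := ⟨fun τ V N hτ _ =>
    aemeasurable_isoFluct hσ hσ2 hτ (Φ N) (continuous_np hψc)⟩
  have hm12 : AEMeasFam μ fun τ V N z =>
      isoFluct σ θ₀ u₀ τ V (Φ N) (pp ψ) z + -isoFluct σ θ₀ u₀ τ V (Φ N) (np ψ) z := ⟨fun τ V N hτ hV =>
    (hm1.out τ V N hτ hV).add (hm2.out τ V N hτ hV).neg⟩
  have hm12n : AEMeasFam μ fun τ V N z =>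
      -isoFluct σ θ₀ u₀ τ V (Φ N) (pp ψ) z + isoFluct σ θ₀ u₀ τ V (Φ N) (np ψ) z := ⟨fun τ V N hτ hV =>
    (hm1.out τ V N hτ hV).neg.add (hm2.out τ V N hτ hV)⟩
  -- the LD data
  have hU1 := hD.upper (pp ψ) (continuous_pp hψc) (pp_nonneg ψ)
  have hL1 := hD.lower (pp ψ) (continuous_pp hψc) (pp_nonneg ψ)
  have hU2 := hD.upper (np ψ) (continuous_np hψc) (np_nonneg ψ)
  have hL2 := hD.lower (np ψ) (continuous_np hψc) (np_nonneg ψ)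
  have hT := hD.traceless (devM φ k) (continuous_devM hφ k) (trace_devM φ k)
  -- positive side
  have hp : UpperLD μ main := (hU1.add hL2 hm1).add hT.upper hm12
  have hp' : UpperLD μ (rowY σ θ₀ u₀ φ Φ (some k)) := by
    refine UpperLD.of_eq (fun τ V N z => ?_) (hp.add_small (C * σ) hrem_bd)
    simp only [hrem]
    ring
  -- negative side
  have hn : UpperLD μ fun τ V N z => -isoFluct σ θ₀ u₀ τ V (Φ N) (pp ψ) z + isoFluct σ θ₀ u₀ τ V (Φ N) (np ψ) z +
      -tracelessFluct σ τ V (Φ N) (devM φ k) z := (hL1.add hU2 hm1n).add hT.upper_neg hm12n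
  have hrem_bd' : ∀ τ V N, 0 < τ → 0 ≤ V → ∀ᵐ z ∂(μ N), |(-rem τ V N z)| ≤ C * σ * V * ((N : ℝ) + 1) ^ (2 / 3 : ℝ) := by
    intro τ V N hτ hV
    filter_upwards [hrem_bd τ V N hτ hV] with z hz
    rwa [abs_neg]
  have hn' : UpperLD μ fun τ V N z => -rowY σ θ₀ u₀ φ Φ (some k) τ V N z := by
    refine UpperLD.of_eq (fun τ V N z => ?_) (hn.add_small (C * σ) hrem_bd')
    simp only [hrem, hmain]
    ring
  exact TwoSidedLD.of_upper hp' hn'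

/-- **The energy row of C′ at fixed data**, two-sided. -/
theorem twoSided_rowY_none (hσ : 0 < σ) (hσ2 : σ < 1 / 2) (hD : LDData σ a₀ θ₀ u₀ Φ) {φ : T3 → ℝ}
    (hφ : Torus.IsSmooth φ) :
    TwoSidedLD (gibbsFam σ a₀ θ₀ u₀ Φ) (rowY σ θ₀ u₀ φ Φ none) := by
  obtain ⟨C, hC0, hC⟩ := stub_collisionDecomposition φ hφ
  set ψ := psiE u₀ φ with hψ
  have hψc : Continuous ψ := continuous_psiE u₀ hφ
  have hbc : ∀ l, Continuous (gradF φ l) := fun l => (hφ.partialDeriv l).continuous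
  set μ := gibbsFam σ a₀ θ₀ u₀ Φ with hμ
  set main : WFun := fun τ V N z =>
    isoFluct σ θ₀ u₀ τ V (Φ N) (pp ψ) z + -isoFluct σ θ₀ u₀ τ V (Φ N) (np ψ) z +
      tracelessFluct σ τ V (Φ N) (devE u₀ φ) z + thermalFluct σ θ₀ u₀ τ V (Φ N) (gradF φ) z with hmain
  set rem : WFun := fun τ V N z => rowY σ θ₀ u₀ φ Φ none τ V N z - main τ V N z with hrem
  have hrem_bd : ∀ τ V N, 0 < τ → 0 ≤ V → ∀ᵐ z ∂(μ N), |rem τ V N z| ≤ C * σ * V * ((N : ℝ) + 1) ^ (2 / 3 : ℝ) := by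
    intro τ V N hτ hV
    filter_upwards [ae_mem_good_localGibbsLaw σ (fun _ => a₀) (fun _ => u₀) (fun _ => θ₀) N (Φ N)] with z hz
    have h5 := (hC σ τ V hσ hσ2 hτ hV N (Φ N) z hz).2
    have h5' : |rowY σ θ₀ u₀ φ Φ none τ V N z + (window τ N)⁻¹ * Arow σ θ₀ u₀ τ φ (Φ N) none z -
        virN σ τ V (Φ N) (gamE φ) z| ≤ C * V * σ * ((N : ℝ) + 1) ^ (2 / 3 : ℝ) := by
      simp only [rowY, sub_add_cancel]
      exact h5
    have hcoll : virN σ τ V (Φ N) (gamE φ) z =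
        virN σ τ V (Φ N) (fun c => pp ψ c.fstPos) z - virN σ τ V (Φ N) (fun c => np ψ c.fstPos) z +
          virN σ τ V (Φ N) (quadWeight (devE u₀ φ)) z + virN σ τ V (Φ N) (thermalWeight u₀ (gradF φ)) z := by
      have e1 : virN σ τ V (Φ N) (gamE φ) z = virN σ τ V (Φ N)
          (fun c => psiE u₀ φ c.fstPos + quadWeight (devE u₀ φ) c + thermalWeight u₀ (gradF φ) c) z := by
        simp only [virN, Rvir_gamE hσ (Φ N) u₀]
      rw [e1, virN_add (Φ N) hz, virN_add (Φ N) hz, ← virN_sub (Φ N) hz]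
      congr 3
      funext c
      exact (pp_sub_np ψ c.fstPos).symm
    have heos : Arow σ θ₀ u₀ τ φ (Φ N) none z =
        isoProjection σ θ₀ u₀ τ (Φ N) (pp ψ) z - isoProjection σ θ₀ u₀ τ (Φ N) (np ψ) z +
          thermalProjection σ θ₀ u₀ τ (Φ N) (gradF φ) z := by
      rw [Arow_none_eq hσ hσ2 hτ (Φ N) hφ hz, isoProjection_pp_np hσ hσ2 hτ (Φ N) hψc hz]
    have hid : rem τ V N z = rowY σ θ₀ u₀ φ Φ none τ V N z +
        (window τ N)⁻¹ * Arow σ θ₀ u₀ τ φ (Φ N) none z - virN σ τ V (Φ N) (gamE φ) z := by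
      simp only [hrem, hmain, isoFluct, tracelessFluct, thermalFluct, hcoll, heos]
      ring
    rw [hid]
    calc _ ≤ C * V * σ * ((N : ℝ) + 1) ^ (2 / 3 : ℝ) := h5'
      _ = C * σ * V * ((N : ℝ) + 1) ^ (2 / 3 : ℝ) := by ring
  -- measurability of partial sums
  have hm1 : AEMeasFam μ fun τ V N => isoFluct σ θ₀ u₀ τ V (Φ N) (pp ψ) := ⟨fun τ V N hτ _ =>
    aemeasurable_isoFluct hσ hσ2 hτ (Φ N) (continuous_pp hψc)⟩
  have hm2 : AEMeasFam μ fun τ V N => isoFluct σ θ₀ u₀ τ V (Φ N) (np ψ) := ⟨fun τ V N hτ _ =>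
    aemeasurable_isoFluct hσ hσ2 hτ (Φ N) (continuous_np hψc)⟩
  have hm3 : AEMeasFam μ fun τ V N => tracelessFluct σ τ V (Φ N) (devE u₀ φ) := ⟨fun τ V N hτ _ =>
    aemeasurable_tracelessFluct hσ hσ2 hτ (Φ N) (continuous_devE u₀ hφ)⟩
  have hm12 : AEMeasFam μ fun τ V N z =>
      isoFluct σ θ₀ u₀ τ V (Φ N) (pp ψ) z + -isoFluct σ θ₀ u₀ τ V (Φ N) (np ψ) z := ⟨fun τ V N hτ hV =>
    (hm1.out τ V N hτ hV).add (hm2.out τ V N hτ hV).neg⟩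
  have hm123 : AEMeasFam μ fun τ V N z =>
      isoFluct σ θ₀ u₀ τ V (Φ N) (pp ψ) z + -isoFluct σ θ₀ u₀ τ V (Φ N) (np ψ) z +
        tracelessFluct σ τ V (Φ N) (devE u₀ φ) z := ⟨fun τ V N hτ hV =>
    (hm12.out τ V N hτ hV).add (hm3.out τ V N hτ hV)⟩
  have hm1n : AEMeasFam μ fun τ V N z => -isoFluct σ θ₀ u₀ τ V (Φ N) (pp ψ) z := ⟨fun τ V N hτ hV =>
    (hm1.out τ V N hτ hV).neg⟩
  have hm12n : AEMeasFam μ fun τ V N z =>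
      -isoFluct σ θ₀ u₀ τ V (Φ N) (pp ψ) z + isoFluct σ θ₀ u₀ τ V (Φ N) (np ψ) z := ⟨fun τ V N hτ hV =>
    (hm1.out τ V N hτ hV).neg.add (hm2.out τ V N hτ hV)⟩
  have hm123n : AEMeasFam μ fun τ V N z =>
      -isoFluct σ θ₀ u₀ τ V (Φ N) (pp ψ) z + isoFluct σ θ₀ u₀ τ V (Φ N) (np ψ) z +
        -tracelessFluct σ τ V (Φ N) (devE u₀ φ) z := ⟨fun τ V N hτ hV =>
    (hm12n.out τ V N hτ hV).add (hm3.out τ V N hτ hV).neg⟩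
  -- the LD data
  have hU1 := hD.upper (pp ψ) (continuous_pp hψc) (pp_nonneg ψ)
  have hL1 := hD.lower (pp ψ) (continuous_pp hψc) (pp_nonneg ψ)
  have hU2 := hD.upper (np ψ) (continuous_np hψc) (np_nonneg ψ)
  have hL2 := hD.lower (np ψ) (continuous_np hψc) (np_nonneg ψ)
  have hT := hD.traceless (devE u₀ φ) (continuous_devE u₀ hφ) (trace_devE u₀ φ)
  have hTh := hD.thermal (gradF φ) hbc
  -- positive side
  have hp : UpperLD μ main := ((hU1.add hL2 hm1).add hT.upper hm12).add hTh.upper hm123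
  have hp' : UpperLD μ (rowY σ θ₀ u₀ φ Φ none) := by
    refine UpperLD.of_eq (fun τ V N z => ?_) (hp.add_small (C * σ) hrem_bd)
    simp only [hrem]
    ring
  -- negative side
  have hn : UpperLD μ fun τ V N z => -isoFluct σ θ₀ u₀ τ V (Φ N) (pp ψ) z + isoFluct σ θ₀ u₀ τ V (Φ N) (np ψ) z +
      -tracelessFluct σ τ V (Φ N) (devE u₀ φ) z + -thermalFluct σ θ₀ u₀ τ V (Φ N) (gradF φ) z :=
    ((hL1.add hU2 hm1n).add hT.upper_neg hm12n).add hTh.upper_neg hm123n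
  have hrem_bd' : ∀ τ V N, 0 < τ → 0 ≤ V → ∀ᵐ z ∂(μ N), |(-rem τ V N z)| ≤ C * σ * V * ((N : ℝ) + 1) ^ (2 / 3 : ℝ) := by
    intro τ V N hτ hV
    filter_upwards [hrem_bd τ V N hτ hV] with z hz
    rwa [abs_neg]
  have hn' : UpperLD μ fun τ V N z => -rowY σ θ₀ u₀ φ Φ none τ V N z := by
    refine UpperLD.of_eq (fun τ V N z => ?_) (hn.add_small (C * σ) hrem_bd')
    simp only [hrem, hmain]
    ring
  exact TwoSidedLD.of_upper hp' hn'

/-- From the four LD hypotheses — the line's registered stub statements S1 `IsotropicUpperTail` (`UpperLD (Y_ψ)`, `ψ ≥ 0`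
continuous), S2 `IsotropicLowerTail` (`UpperLD (−Y_ψ)`), S3 `TracelessVirialLD` (`TwoSidedLD (T_S)`, `S` continuous traceless),
S4 `ThermalTransferLD` (`TwoSidedLD (Θ_b)`, `b` continuous), written with the LD template — to the LD data at fixed `(σ, a₀, θ₀, u₀, Φ)`. -/
theorem ldData_of_hyps
    (hS1 : (∃ σ₀ : ℝ, 0 < σ₀ ∧ ∀ (a₀ θ₀ : ℝ) (u₀ : V3), 0 < a₀ → 0 < θ₀ → ∀ σ : ℝ, 0 < σ → σ < σ₀ →
      ∀ Φ : Flows σ, ∀ ψ : T3 → ℝ, Continuous ψ → (∀ x, 0 ≤ ψ x) →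
        UpperLD (gibbsFam σ a₀ θ₀ u₀ Φ) fun τ V N => isoFluct σ θ₀ u₀ τ V (Φ N) ψ))
    (hS2 : (∃ σ₀ : ℝ, 0 < σ₀ ∧ ∀ (a₀ θ₀ : ℝ) (u₀ : V3), 0 < a₀ → 0 < θ₀ → ∀ σ : ℝ, 0 < σ → σ < σ₀ →
      ∀ Φ : Flows σ, ∀ ψ : T3 → ℝ, Continuous ψ → (∀ x, 0 ≤ ψ x) →
        UpperLD (gibbsFam σ a₀ θ₀ u₀ Φ) fun τ V N z => -isoFluct σ θ₀ u₀ τ V (Φ N) ψ z))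
    (hS3 : (∃ σ₀ : ℝ, 0 < σ₀ ∧ ∀ (a₀ θ₀ : ℝ) (u₀ : V3), 0 < a₀ → 0 < θ₀ → ∀ σ : ℝ, 0 < σ → σ < σ₀ →
      ∀ Φ : Flows σ, ∀ S : T3 → Fin 3 → Fin 3 → ℝ, (∀ a b, Continuous fun x => S x a b) → (∀ x, ∑ a, S x a a = 0) →
        TwoSidedLD (gibbsFam σ a₀ θ₀ u₀ Φ) fun τ V N => tracelessFluct σ τ V (Φ N) S))
    (hS4 : (∃ σ₀ : ℝ, 0 < σ₀ ∧ ∀ (a₀ θ₀ : ℝ) (u₀ : V3), 0 < a₀ → 0 < θ₀ → ∀ σ : ℝ, 0 < σ → σ < σ₀ →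
      ∀ Φ : Flows σ, ∀ b : Fin 3 → T3 → ℝ, (∀ l, Continuous (b l)) →
        TwoSidedLD (gibbsFam σ a₀ θ₀ u₀ Φ) fun τ V N => thermalFluct σ θ₀ u₀ τ V (Φ N) b)) :
    ∃ σ₀ : ℝ, 0 < σ₀ ∧ ∀ (a₀ θ₀ : ℝ) (u₀ : V3), 0 < a₀ → 0 < θ₀ → ∀ σ : ℝ, 0 < σ → σ < σ₀ →
      ∀ Φ : Flows σ, LDData σ a₀ θ₀ u₀ Φ := by
  obtain ⟨σ₁, hσ₁, h1⟩ := hS1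
  obtain ⟨σ₂, hσ₂, h2⟩ := hS2
  obtain ⟨σ₃, hσ₃, h3⟩ := hS3
  obtain ⟨σ₄, hσ₄, h4⟩ := hS4
  refine ⟨min (min σ₁ σ₂) (min σ₃ σ₄), lt_min (lt_min hσ₁ hσ₂) (lt_min hσ₃ hσ₄), ?_⟩
  intro a₀ θ₀ u₀ ha hθ σ hσ hσlt Φ
  have hσ₁' : σ < σ₁ := hσlt.trans_le ((min_le_left _ _).trans (min_le_left _ _))
  have hσ₂' : σ < σ₂ := hσlt.trans_le ((min_le_left _ _).trans (min_le_right _ _))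
  have hσ₃' : σ < σ₃ := hσlt.trans_le ((min_le_right _ _).trans (min_le_left _ _))
  have hσ₄' : σ < σ₄ := hσlt.trans_le ((min_le_right _ _).trans (min_le_right _ _))
  exact
    { upper := fun ψ hψ hψ0 => h1 a₀ θ₀ u₀ ha hθ σ hσ hσ₁' Φ ψ hψ hψ0
      lower := fun ψ hψ hψ0 => h2 a₀ θ₀ u₀ ha hθ σ hσ hσ₂' Φ ψ hψ hψ0
      traceless := fun S hS hS0 => h3 a₀ θ₀ u₀ ha hθ σ hσ hσ₃' Φ S hS hS0
      thermal := fun b hb => h4 a₀ θ₀ u₀ ha hθ σ hσ hσ₄' Φ b hb }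

/-- **The transfer (the planner's `stub_polarization`, now a theorem; S5–S7 landed): the four LD statements imply C′**,
stated in the named objects of the shared vocabulary — by `Iff.rfl` this conclusion is the repaired crux `ClampedTransferWindowLD`
VERBATIM (the filed decl with the transfer-activity clamp; dictionary lemma `clampedTransferWindowLD_iff` of the line's skeleton), and the
hypotheses are the registered stub statements S1–S4 written with the LD template. -/
theorem clampedTransferWindowLD_of_radialVirialLD
    (hS1 : (∃ σ₀ : ℝ, 0 < σ₀ ∧ ∀ (a₀ θ₀ : ℝ) (u₀ : V3), 0 < a₀ → 0 < θ₀ → ∀ σ : ℝ, 0 < σ → σ < σ₀ →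
      ∀ Φ : Flows σ, ∀ ψ : T3 → ℝ, Continuous ψ → (∀ x, 0 ≤ ψ x) →
        UpperLD (gibbsFam σ a₀ θ₀ u₀ Φ) fun τ V N => isoFluct σ θ₀ u₀ τ V (Φ N) ψ))
    (hS2 : (∃ σ₀ : ℝ, 0 < σ₀ ∧ ∀ (a₀ θ₀ : ℝ) (u₀ : V3), 0 < a₀ → 0 < θ₀ → ∀ σ : ℝ, 0 < σ → σ < σ₀ →
      ∀ Φ : Flows σ, ∀ ψ : T3 → ℝ, Continuous ψ → (∀ x, 0 ≤ ψ x) →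
        UpperLD (gibbsFam σ a₀ θ₀ u₀ Φ) fun τ V N z => -isoFluct σ θ₀ u₀ τ V (Φ N) ψ z))
    (hS3 : (∃ σ₀ : ℝ, 0 < σ₀ ∧ ∀ (a₀ θ₀ : ℝ) (u₀ : V3), 0 < a₀ → 0 < θ₀ → ∀ σ : ℝ, 0 < σ → σ < σ₀ →
      ∀ Φ : Flows σ, ∀ S : T3 → Fin 3 → Fin 3 → ℝ, (∀ a b, Continuous fun x => S x a b) → (∀ x, ∑ a, S x a a = 0) →
        TwoSidedLD (gibbsFam σ a₀ θ₀ u₀ Φ) fun τ V N => tracelessFluct σ τ V (Φ N) S))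
    (hS4 : (∃ σ₀ : ℝ, 0 < σ₀ ∧ ∀ (a₀ θ₀ : ℝ) (u₀ : V3), 0 < a₀ → 0 < θ₀ → ∀ σ : ℝ, 0 < σ → σ < σ₀ →
      ∀ Φ : Flows σ, ∀ b : Fin 3 → T3 → ℝ, (∀ l, Continuous (b l)) →
        TwoSidedLD (gibbsFam σ a₀ θ₀ u₀ Φ) fun τ V N => thermalFluct σ θ₀ u₀ τ V (Φ N) b)) :
    ∃ σ₀ : ℝ, 0 < σ₀ ∧ ∀ (a₀ θ₀ : ℝ) (u₀ : V3), 0 < a₀ → 0 < θ₀ → ∀ σ : ℝ, 0 < σ → σ < σ₀ →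
      ∀ Φ : (N : ℕ) → Flow σ N, ∀ φ : T3 → ℝ, Torus.IsSmooth φ → ∃ V₀ : ℝ, 0 < V₀ ∧ ∀ V : ℝ, V₀ ≤ V →
        ∃ β₀ : ℝ, 0 < β₀ ∧ ∀ β : ℝ, |β| ≤ β₀ → ∀ ε : ℝ, 0 < ε → ∃ τ₀ : ℝ, 0 < τ₀ ∧ ∀ τ : ℝ, τ₀ ≤ τ →
          ∃ N₀ : ℕ, ∀ N : ℕ, N₀ ≤ N →
            (∀ k : Fin 3,
              ∫⁻ z, ENNReal.ofReal (Real.exp (β * ((window τ N)⁻¹ * Xrow σ τ V φ (Φ N) (some k) z -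
                  (window τ N)⁻¹ * Arow σ θ₀ u₀ τ φ (Φ N) (some k) z))) ∂(gibbs σ a₀ θ₀ u₀ N (Φ N)) ≤
                ENNReal.ofReal (Real.exp (ε * ((N : ℝ) + 1)))) ∧
            ∫⁻ z, ENNReal.ofReal (Real.exp (β * ((window τ N)⁻¹ * Xrow σ τ V φ (Φ N) none z -
                (window τ N)⁻¹ * Arow σ θ₀ u₀ τ φ (Φ N) none z))) ∂(gibbs σ a₀ θ₀ u₀ N (Φ N)) ≤
              ENNReal.ofReal (Real.exp (ε * ((N : ℝ) + 1))) := by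
  obtain ⟨σ₀, hσ₀, hD⟩ := ldData_of_hyps hS1 hS2 hS3 hS4
  refine ⟨min σ₀ (1 / 2), lt_min hσ₀ (by norm_num), ?_⟩
  intro a₀ θ₀ u₀ ha hθ σ hσ hσlt Φ φ hφ
  have hσ₀' : σ < σ₀ := hσlt.trans_le (min_le_left _ _)
  have hσ2 : σ < 1 / 2 := hσlt.trans_le (min_le_right _ _)
  have hData := hD a₀ θ₀ u₀ ha hθ σ hσ hσ₀' Φ
  have hk : ∀ k : Fin 3, TwoSidedLD (gibbsFam σ a₀ θ₀ u₀ Φ) (rowY σ θ₀ u₀ φ Φ (some k)) := fun k =>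
    twoSided_rowY_some hσ hσ2 hData hφ k
  have he : TwoSidedLD (gibbsFam σ a₀ θ₀ u₀ Φ) (rowY σ θ₀ u₀ φ Φ none) := twoSided_rowY_none hσ hσ2 hData hφ
  exact ((LDPrefix.forall_fin3 fun k => (hk k).out).and he.out).out

end Assembly

end RadialVirial

end Summit.AtomisticToContinuum.HydrodynamicLimit.Theorems.ClampedTransferCoin

end
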